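import Summits.NavierStokesRegularity.NavierStokesRegularity.Theorems.LocalSineTubeDoorProfileAlignedWindowRigidity
import Summits.NavierStokesRegularity.NavierStokesRegularity.Theorems.SqueezeCycleExtremalElementExistsExtraction
import Summits.NavierStokesRegularity.NavierStokesRegularity.Theorems.ScaledTopAlignmentWindowBridge
import Summits.NavierStokesRegularity.NavierStokesRegularity.Theorems.ClockStretchingLawClockCeilingStubTranslationInvariantAfter
import Literature.Analysis.FluidPDE.VorticityCalculus
import HarnessLib

/-!
# Route `ScaledTopAlignment`, crux W3ᵐᵗ = `AprioriMostTimesBulkAlignment` (stmt-NavierStokesRegularity-19551):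
# Type-I blow-up PROFILES are UNIFORMLY window-decoherent — the quantitative form of the aligned-window kill

Every door of the route (W3, W3′, W3ʷᵇ, W3ᵐᵗ, the class-#2 redirect H₂/H₂ʷ) is killed at a Type-I first blow-up by
the same endgame: the Type-I zoom produces a profile of the class `IsTypeIAncientMild C` (unit viscosity, Oseen
gauge) one of whose vorticity slices is parallel to a fixed vector on an open window, and such a profile vanishes
(route LocalSineTubeDoor's `eq_zero_of_aligned_window`: slice analyticity, planar descent, KNSS's Type-I planar
Liouville). This file upgrades that EXACT rigidity to a UNIFORM QUANTITATIVE one by the `C¹_loc` compactness of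
the Type-I class (`exists_tendsto_of_isTypeIAncientMild_seq`, KNSS 2009 Prop. 4.1 / Lemma 6.1):

* spatial translations preserve the class (tree: `translationInvariantAfter_isTypeIAncientMild_comp_add_right`,
  route ClockStretchingLaw), so window centres may be moved to the origin;
* **`typeIAncientMild_uniform_window_decoherence`** — for every Type-I constant `C`, amplitude floor `κ > 0`,
  relative level `λ₀ < 1`, window radius `R₀ > 0` and slice time `s < 0` there is ONE `ε > 0` such that for
  EVERY profile `W ∈ IsTypeIAncientMild C`, every point `y₀` with `κ ≤ |curl W(s)(y₀)|` and every direction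
  `e ≠ 0`, some point `y` of the `λ₀`-relative top set `λ₀|curl W(s)(y₀)| ≤ |curl W(s)(y)|` inside the window
  `|y₀ − y| ≤ R₀√(1/|curl W(s)(y₀)|)` has direction sine `sin∠(e, curl W(s)(y)) > ε`. Proof: otherwise windows
  of profiles `W_n` around `y₀ⁿ` are `1/(n+1)`-aligned with unit anchors `e_n`; translate `y₀ⁿ` to the origin,
  extract a `C¹_loc`-convergent subsequence of the profiles and a convergent subsequence of the anchors
  (`e_∞ ∈ 𝕊²`); the limit profile has `|curl W_∞(s)(0)| ≥ κ`, so its window contains a ball around `0`, on which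
  the direction sine against `e_∞` vanishes (continuity of the sine at non-zero vectors, `tendsto_dirSine`);
  `cross_eq_zero_of_dirSine_eq_zero` and `eq_zero_of_aligned_window` force `W_∞ ≡ 0`, contradicting
  `|curl W_∞(s)(0)| ≥ κ > 0`;
* `typeIAncientMild_uniform_window_decoherence_anchored` — the same with the anchor `e = curl W(s)(y₀)` (the
  form read by the doors W3ʷᵇ/W3ᵐᵗ/H₂ʷ of record): every rate-floor window of every Type-I profile carries
  a point of the relative top set misaligned with the CENTRE by more than `ε(C, κ, λ₀, R₀, s)`.

Consequences for the line (census of the §C seat ns-sta-19551-p2): the profile-side content of every alignment door is not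
only «an aligned window is impossible» but «alignment better than ε(C) is impossible, uniformly over the Type-I(C)
class» — the sup-sine analogue of the planner's compactness rung Q(C) `TypeIUniformDecoherence` (cell p3 g4,
split-9/Split9.lean), proved; it is what a falsifiable DNS proxy can test (a finite threshold, not `∀ ε`).
`ε` is obtained by compactness and is not explicit. WHAT THIS IS NOT: not NS regularity and not a statement
about Type-II blow-up; a theorem about the (possibly trivial) class of Type-I ancient mild profiles. [folklore]
-/

noncomputable section

-- the summit and its single sub-problem share the name (CONVENTIONS §1), as in every Theorems file
set_option linter.dupNamespace false

open Set Function Filter Topology Metric MeasureTheory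
open scoped RealInnerProductSpace
open Literature.Analysis Literature.Analysis.FluidPDE
open Summit.NavierStokesRegularity.NavierStokesRegularity.Theorems.LocalSineTubeDoorProfileAlignedWindowRigidity

namespace Summit.NavierStokesRegularity.NavierStokesRegularity.Theorems

/-! ### Uniform window decoherence of Type-I profiles -/

/-- **Type-I blow-up profiles are uniformly window-decoherent (every anchor).** For every `C`, `κ > 0`,
`λ₀ < 1`, `R₀ > 0` and `s < 0` there is `ε > 0` such that for every `W ∈ IsTypeIAncientMild C`, every `y₀` with
`κ ≤ |curl W(s)(y₀)|` and every `e ≠ 0`, some `y` with `λ₀|curl W(s)(y₀)| ≤ |curl W(s)(y)|` and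
`|y₀ − y| ≤ R₀√(1/|curl W(s)(y₀)|)` has `ε < √(1 − ⟪e/|e|, ξ(y)⟫²)`, `ξ = curl W(s)/|curl W(s)|`. Compactness
of the Type-I class (`exists_tendsto_of_isTypeIAncientMild_seq`) and of the sphere of anchors, continuity of the
direction sine at non-zero vectors (`tendsto_dirSine`), and the aligned-window rigidity `eq_zero_of_aligned_window`
(module docstring). [cite: KochNadirashviliSereginSverak2009, Prop. 4.1 and Lemma 6.1 (arXiv:0709.3599 pp. 8, 11); GigaMiura2011, §2] -/
theorem typeIAncientMild_uniform_window_decoherence {C κ lam0 R0 s : ℝ} (hκ : 0 < κ) (hlam1 : lam0 < 1)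
    (hR0 : 0 < R0) (hs : s < 0) :
    ∃ ε : ℝ, 0 < ε ∧ ∀ (W : ℝ → EuclideanSpace ℝ (Fin 3) → EuclideanSpace ℝ (Fin 3)), IsTypeIAncientMild C W →
      ∀ y0 : EuclideanSpace ℝ (Fin 3), κ ≤ ‖curl (W s) y0‖ → ∀ e : EuclideanSpace ℝ (Fin 3), e ≠ 0 →
        ∃ y : EuclideanSpace ℝ (Fin 3), lam0 * ‖curl (W s) y0‖ ≤ ‖curl (W s) y‖ ∧
          ‖y0 - y‖ ≤ R0 * Real.sqrt (1 / ‖curl (W s) y0‖) ∧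
          ε < Real.sqrt (1 - (inner ℝ (‖e‖⁻¹ • e) (‖curl (W s) y‖⁻¹ • curl (W s) y)) ^ 2) := by
  by_contra hcon
  push Not at hcon
  have hseq : ∀ n : ℕ, ∃ W : ℝ → EuclideanSpace ℝ (Fin 3) → EuclideanSpace ℝ (Fin 3), IsTypeIAncientMild C W ∧
      ∃ y0 : EuclideanSpace ℝ (Fin 3), κ ≤ ‖curl (W s) y0‖ ∧ ∃ e : EuclideanSpace ℝ (Fin 3), e ≠ 0 ∧
        ∀ y : EuclideanSpace ℝ (Fin 3), lam0 * ‖curl (W s) y0‖ ≤ ‖curl (W s) y‖ →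
          ‖y0 - y‖ ≤ R0 * Real.sqrt (1 / ‖curl (W s) y0‖) →
          Real.sqrt (1 - (inner ℝ (‖e‖⁻¹ • e) (‖curl (W s) y‖⁻¹ • curl (W s) y)) ^ 2) ≤ 1 / ((n : ℝ) + 1) :=
    fun n => hcon _ (by positivity)
  choose W hW y0 hy0 e he hal using hseq
  -- ## translate the window centres to the origin
  set V : ℕ → ℝ → EuclideanSpace ℝ (Fin 3) → EuclideanSpace ℝ (Fin 3) := fun n t x => W n t (x + y0 n) with hV
  have hVcl : ∀ n, IsTypeIAncientMild C (V n) := fun n =>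
    translationInvariantAfter_isTypeIAncientMild_comp_add_right (hW n) (y0 n)
  have hcurlV : ∀ n y, curl (V n s) y = curl (W n s) (y + y0 n) := fun n y => by
    simp only [hV, curl, fderiv_comp_add_right]
  -- ## compactness of the class and of the sphere of unit anchors
  obtain ⟨φ, hφ, U, hU, -, hptD, -, -⟩ := exists_tendsto_of_isTypeIAncientMild_seq C hVcl
  set f : ℕ → EuclideanSpace ℝ (Fin 3) := fun n => ‖e n‖⁻¹ • e n with hf
  have hf1 : ∀ n, ‖f n‖ = 1 := fun n => norm_smul_inv_norm (he n)
  obtain ⟨eInf, heInfmem, ψ, hψ, hfψ⟩ := (isCompact_sphere (0 : EuclideanSpace ℝ (Fin 3)) 1).tendsto_subseq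
    (fun n => show f (φ n) ∈ sphere (0 : EuclideanSpace ℝ (Fin 3)) 1 from
      mem_sphere_zero_iff_norm.2 (hf1 (φ n)))
  have heInf1 : ‖eInf‖ = 1 := mem_sphere_zero_iff_norm.1 heInfmem
  have heInf0 : eInf ≠ 0 := by
    intro h0; rw [h0, norm_zero] at heInf1; exact zero_ne_one heInf1
  set θ : ℕ → ℕ := φ ∘ ψ with hθ
  have hθt : Tendsto θ atTop atTop := hφ.tendsto_atTop.comp hψ.tendsto_atTop
  -- vorticity convergence at time `s`, pointwise, along `θ`
  have hω : ∀ y, Tendsto (fun j => curl (V (θ j) s) y) atTop (𝓝 (curl (U s) y)) := fun y => by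
    have h1 : Tendsto (fun j => fderiv ℝ (V (φ (ψ j)) s) y) atTop (𝓝 (fderiv ℝ (U s) y)) :=
      (hptD s hs y).comp hψ.tendsto_atTop
    rw [show (fun j => curl (V (θ j) s) y) = curlCLM ∘ (fun j => fderiv ℝ (V (φ (ψ j)) s) y) from rfl,
      show curl (U s) y = curlCLM (fderiv ℝ (U s) y) from rfl]
    exact (curlCLM.continuous.tendsto _).comp h1
  -- the limit amplitude at the origin
  set a : EuclideanSpace ℝ (Fin 3) := curl (U s) 0 with ha
  have hκa : κ ≤ ‖a‖ := by
    refine ge_of_tendsto (hω 0).norm (Eventually.of_forall fun j => ?_)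
    rw [hcurlV, zero_add]
    exact hy0 (θ j)
  have hapos : 0 < ‖a‖ := hκ.trans_le hκa
  have ha0 : a ≠ 0 := norm_pos_iff.1 hapos
  -- the limit profile and its vorticity slice
  have hmildU : ∀ s' t : ℝ, s' < t → t < 0 → ∀ y : EuclideanSpace ℝ (Fin 3),
      U t y = UnboundedOperators.heatExtension (U s') (t - s') y - oseenDuhamel 1 s' U U t y :=
    fun s' t hst ht y => hU.mild_eq_heatExtension hst ht y
  have hUc : Continuous (curl (U s)) :=
    continuous_curl_slice hU.hasTypeITimeDecay hU.continuousOn_uncurry hmildU hs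
  -- ## a ball around the origin inside every late window
  set lam' : ℝ := max lam0 0 with hlam'
  have hlam'1 : lam' < 1 := max_lt hlam1 one_pos
  have hlam'0 : 0 ≤ lam' := le_max_right _ _
  set m : ℝ := (1 - lam') / 2 * ‖a‖ with hm
  have hm0 : 0 < m := by have : 0 < 1 - lam' := by linarith
                         positivity
  obtain ⟨r₁, hr₁, hr₁'⟩ : ∃ r₁ > 0, ∀ y : EuclideanSpace ℝ (Fin 3), ‖y‖ < r₁ → ‖curl (U s) y - a‖ < m := by
    have hc := Metric.continuousAt_iff.1 (hUc.continuousAt (x := 0)) m hm0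
    obtain ⟨δ, hδ, h⟩ := hc
    refine ⟨δ, hδ, fun y hy => ?_⟩
    have := h (by rwa [dist_zero_right])
    rwa [dist_eq_norm] at this
  set r : ℝ := min r₁ (R0 * Real.sqrt (1 / (2 * ‖a‖))) with hr
  have hr0 : 0 < r := lt_min hr₁ (by positivity)
  -- on the ball `B(0,r)`: non-zero vorticity, strictly above the relative level, sine against `eInf` zero
  have hball : ∀ y : EuclideanSpace ℝ (Fin 3), ‖y‖ < r →
      curl (U s) y ≠ 0 ∧ lam0 * ‖a‖ < ‖curl (U s) y‖ := by
    intro y hy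
    have hy1 : ‖y‖ < r₁ := lt_of_lt_of_le hy (min_le_left _ _)
    have hclose := hr₁' y hy1
    have hlow : ‖a‖ - m < ‖curl (U s) y‖ := by
      have := norm_sub_norm_le a (curl (U s) y)
      rw [norm_sub_rev] at hclose
      linarith
    have hlev : lam0 * ‖a‖ < ‖curl (U s) y‖ := by
      have h1 : lam0 * ‖a‖ ≤ lam' * ‖a‖ := mul_le_mul_of_nonneg_right (le_max_left _ _) hapos.le
      have h2 : lam' * ‖a‖ ≤ ‖a‖ - m := by rw [hm]; nlinarith
      linarith
    have hpos : 0 < ‖curl (U s) y‖ := by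
      have h2 : 0 ≤ ‖a‖ - m := by rw [hm]; nlinarith
      linarith
    exact ⟨norm_pos_iff.1 hpos, hlev⟩
  have hzeroSeq : Tendsto (fun j : ℕ => 1 / ((θ j : ℝ) + 1)) atTop (𝓝 0) :=
    tendsto_one_div_add_atTop_nhds_zero_nat.comp hθt
  have hal' : ∀ y ∈ ball (0 : EuclideanSpace ℝ (Fin 3)) r, cross (curl (U s) y) eInf = 0 := by
    intro y hy
    rw [mem_ball, dist_zero_right] at hy
    obtain ⟨hb0, hlev⟩ := hball y hy
    -- the sines against the unit anchors converge to the sine against `eInf`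
    have hlim : Tendsto (fun j => Real.sqrt (1 - (inner ℝ (‖f (θ j)‖⁻¹ • f (θ j))
        (‖curl (V (θ j) s) y‖⁻¹ • curl (V (θ j) s) y)) ^ 2)) atTop
        (𝓝 (Real.sqrt (1 - (inner ℝ (‖eInf‖⁻¹ • eInf) (‖curl (U s) y‖⁻¹ • curl (U s) y)) ^ 2))) :=
      tendsto_dirSine heInf0 hb0 hfψ (hω y)
    -- eventually `y` lies in the window of the translated profile and the sine is `≤ 1/(θ j + 1)`
    have hn0 : Tendsto (fun j => ‖curl (V (θ j) s) 0‖) atTop (𝓝 ‖a‖) := (hω 0).norm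
    have hny : Tendsto (fun j => ‖curl (V (θ j) s) y‖) atTop (𝓝 ‖curl (U s) y‖) := (hω y).norm
    have e1 : ∀ᶠ j in atTop, ‖curl (V (θ j) s) 0‖ < 2 * ‖a‖ := hn0.eventually_lt_const (by linarith)
    have e2 : ∀ᶠ j in atTop, 0 < ‖curl (V (θ j) s) y‖ - lam0 * ‖curl (V (θ j) s) 0‖ :=
      (hny.sub (hn0.const_mul lam0)).eventually_const_lt (by linarith)
    have e3 : ∀ᶠ j in atTop, ‖a‖ / 2 < ‖curl (V (θ j) s) 0‖ := hn0.eventually_const_lt (by linarith)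
    have hev : ∀ᶠ j in atTop, Real.sqrt (1 - (inner ℝ (‖f (θ j)‖⁻¹ • f (θ j))
        (‖curl (V (θ j) s) y‖⁻¹ • curl (V (θ j) s) y)) ^ 2) ≤ 1 / ((θ j : ℝ) + 1) := by
      filter_upwards [e1, e2, e3] with j h1 h2 h3
      have hunit : ‖f (θ j)‖⁻¹ • f (θ j) = ‖e (θ j)‖⁻¹ • e (θ j) := by
        rw [hf1, inv_one, one_smul]
      have hcen : 0 < ‖curl (V (θ j) s) 0‖ := by linarith
      -- relative level
      have hrel : lam0 * ‖curl (W (θ j) s) (y0 (θ j))‖ ≤ ‖curl (W (θ j) s) (y + y0 (θ j))‖ := by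
        have := h2
        rw [hcurlV, hcurlV, zero_add] at this
        linarith
      -- inside the window
      have hwin : ‖y0 (θ j) - (y + y0 (θ j))‖ ≤ R0 * Real.sqrt (1 / ‖curl (W (θ j) s) (y0 (θ j))‖) := by
        have e0 : y0 (θ j) - (y + y0 (θ j)) = -y := by abel
        rw [e0, norm_neg]
        have hc0 : ‖curl (W (θ j) s) (y0 (θ j))‖ = ‖curl (V (θ j) s) 0‖ := by rw [hcurlV, zero_add]
        rw [hc0]
        have hy2 : ‖y‖ < R0 * Real.sqrt (1 / (2 * ‖a‖)) := lt_of_lt_of_le hy (min_le_right _ _)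
        have hmono : Real.sqrt (1 / (2 * ‖a‖)) ≤ Real.sqrt (1 / ‖curl (V (θ j) s) 0‖) :=
          Real.sqrt_le_sqrt (one_div_le_one_div_of_le hcen h1.le)
        nlinarith [mul_le_mul_of_nonneg_left hmono hR0.le]
      have := hal (θ j) (y + y0 (θ j)) hrel hwin
      rw [hunit, hcurlV]
      exact this
    have hle : Real.sqrt (1 - (inner ℝ (‖eInf‖⁻¹ • eInf) (‖curl (U s) y‖⁻¹ • curl (U s) y)) ^ 2) ≤ 0 :=
      le_of_tendsto_of_tendsto hlim hzeroSeq hev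
    have hzero : Real.sqrt (1 - (inner ℝ (‖eInf‖⁻¹ • eInf) (‖curl (U s) y‖⁻¹ • curl (U s) y)) ^ 2) = 0 :=
      le_antisymm hle (dirSine_nonneg _ _)
    exact cross_eq_zero_of_dirSine_eq_zero heInf0 hb0 hzero
  -- ## the aligned-window rigidity forces the limit profile to vanish
  have hUzero : ∀ t < 0, ∀ y, U t y = 0 :=
    eq_zero_of_aligned_window hU.hasTypeITimeDecay hU.continuousOn_uncurry hmildU
      (fun t ht => hU.isDivFree ht) hs heInf0 isOpen_ball ⟨0, mem_ball_self hr0⟩ hal'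
  have hUs : U s = fun _ => (0 : EuclideanSpace ℝ (Fin 3)) := funext fun y => hUzero s hs y
  have ha' : a = 0 := by
    rw [ha]
    apply curl_eq_zero_of_fderiv_eq_zero
    rw [hUs]
    simp
  exact ha0 ha'

/-- **Type-I blow-up profiles are uniformly window-decoherent (anchor at the centre).** Same statement with the
anchor `e = curl W(s)(y₀)` — the window form read by the doors of record (W3ʷᵇ / W3ᵐᵗ / H₂ʷ): for every `C`,
`κ > 0`, `λ₀ < 1`, `R₀ > 0`, `s < 0` there is ONE `ε > 0` such that in every profile `W ∈ IsTypeIAncientMild C`,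
around every point `y₀` with `κ ≤ |curl W(s)(y₀)|`, some point of the `λ₀`-relative top set within
`R₀√(1/|curl W(s)(y₀)|)` of `y₀` has direction sine against `ξ(y₀)` larger than `ε`. [folklore] -/
theorem typeIAncientMild_uniform_window_decoherence_anchored {C κ lam0 R0 s : ℝ} (hκ : 0 < κ)
    (hlam1 : lam0 < 1) (hR0 : 0 < R0) (hs : s < 0) :
    ∃ ε : ℝ, 0 < ε ∧ ∀ (W : ℝ → EuclideanSpace ℝ (Fin 3) → EuclideanSpace ℝ (Fin 3)), IsTypeIAncientMild C W →
      ∀ y0 : EuclideanSpace ℝ (Fin 3), κ ≤ ‖curl (W s) y0‖ →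
        ∃ y : EuclideanSpace ℝ (Fin 3), lam0 * ‖curl (W s) y0‖ ≤ ‖curl (W s) y‖ ∧
          ‖y0 - y‖ ≤ R0 * Real.sqrt (1 / ‖curl (W s) y0‖) ∧
          ε < Real.sqrt (1 - (inner ℝ (‖curl (W s) y0‖⁻¹ • curl (W s) y0)
            (‖curl (W s) y‖⁻¹ • curl (W s) y)) ^ 2) := by
  obtain ⟨ε, hε, h⟩ := typeIAncientMild_uniform_window_decoherence (C := C) hκ hlam1 hR0 hs
  refine ⟨ε, hε, fun W hW y0 hy0 => h W hW y0 hy0 (curl (W s) y0) ?_⟩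
  have : 0 < ‖curl (W s) y0‖ := hκ.trans_le hy0
  exact norm_pos_iff.1 this

end Summit.NavierStokesRegularity.NavierStokesRegularity.Theorems

end
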